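import Summits.AtomisticToContinuum.Crystallization.Theorems.OverbindingBudgetAffineLayerSpread
import Summits.AtomisticToContinuum.Crystallization.Theorems.OverbindingBudgetAffineDualBesselDemo
import Literature.Algebra.EuclideanLattices.PQCLLLProofs
import Literature.Algebra.EuclideanLattices.LLLAlgorithmTermination

/-!
# Far-layer spread, CERTIFIED: `covol Λ_B = √det Gram`, distance lower bounds, and the consumer
# `abs_layerSum_sub_layerSum_le_of_check` of the dual Bessel kernel (g66 Deliverable C)

Imports g65 `…LayerSpread` (`abs_layerSum_sub_layerSum_le`) and g66 `…DualBesselDemo` (kernel + soundness + demo rows) and the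
Literature volume formula `covolume_latticeOfBasis_eq_prod_norm_gramSchmidt` / `det_gram_eq_prod_sq_norm_gramSchmidt`.
* §C1 `covolume_span_eq_sqrt_gramDet`: `covol(ℤb₀+ℤb₁) = √(‖b₀‖²‖b₁‖² − ⟪b₀,b₁⟫²)` in any finite-dimensional real inner product
  space with its Borel volume (this is the identification left open in g65 LayerSpread's docstring);
* §C2 `abs_inner_div_norm_le_norm_sub_starProjection`: `|⟪s,ν⟫|/‖ν‖ ≤ ‖s − P_K s‖` for `ν ∈ Kᗮ`, and `mem_orthogonal_span_pair`;
* §C3 ★ `abs_layerSum_sub_layerSum_le_of_check`: a row `R` with `R.check = true`, `R.μ + 1 = σ`, Gram enclosures containing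
  `(⟪Btₐ,Bt_b⟫)` and `R.dlo ≤ d_k` gives `|layerSum B (2σ) k o − layerSum B (2σ) k o'| ≤ 4π/(Γ(σ)√(R.Dlo))·R.bound`;
* §C4 demo (hcp reference cell `B = id`): layer Gram `(1, 1/2, 1)`, `d_k ≥ |k|√(2/3)`, and the end-to-end certificates
  `|layerSum id 12 k o − layerSum id 12 k o'| ≤ 4.44·10⁻¹¹`, `|layerSum id 6 k o − layerSum id 6 k o'| ≤ 8.98·10⁻¹⁰` for `|k| ≥ 4`.
No `sorry`; axioms standard.
-/

noncomputable section

open MeasureTheory Set Module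
open scoped Real InnerProductSpace

namespace Summit.AtomisticToContinuum.Crystallization.Theorems.OverbindingBudgetAffineFarSmoothSplit
open Literature.MathematicalPhysics.StatisticalMechanics Literature.Algebra.EuclideanLattices
  Literature.Analysis.FunctionSpaces
local notation "E3" => EuclideanSpace ℝ (Fin 3)

/-! ## §C1 The covolume of a planar lattice from its Gram matrix -/

section Covolume

variable {W : Type*} [NormedAddCommGroup W] [InnerProductSpace ℝ W] [FiniteDimensional ℝ W]
  [MeasurableSpace W] [BorelSpace W]

/-- `covol(ℤb₀ + ℤb₁)² = det Gram(b₀, b₁) = ‖b₀‖²‖b₁‖² − ⟪b₀,b₁⟫²` (Literature: covolume = `∏ ‖b*ᵢ‖`,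
`det Gram = ∏ ‖b*ᵢ‖²`). [cite: Cohen1993, Prop. 2.5.4] -/
theorem covolume_span_sq_eq_gramDet (b : Module.Basis (Fin 2) ℝ W) :
    ZLattice.covolume (Submodule.span ℤ (Set.range ⇑b)) ^ 2 = ‖b 0‖ ^ 2 * ‖b 1‖ ^ 2 - ⟪b 0, b 1⟫_ℝ ^ 2 := by
  have h1 : ZLattice.covolume (Submodule.span ℤ (Set.range ⇑b)) = ∏ i, ‖InnerProductSpace.gramSchmidt ℝ (⇑b) i‖ :=
    covolume_latticeOfBasis_eq_prod_norm_gramSchmidt b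
  have h2 := det_gram_eq_prod_sq_norm_gramSchmidt (⇑b)
  have h3 : (Matrix.gram ℝ ⇑b).det = ‖b 0‖ ^ 2 * ‖b 1‖ ^ 2 - ⟪b 0, b 1⟫_ℝ ^ 2 := by
    rw [Matrix.det_fin_two, Matrix.gram_apply, Matrix.gram_apply, Matrix.gram_apply, Matrix.gram_apply,
      real_inner_self_eq_norm_sq, real_inner_self_eq_norm_sq, real_inner_comm (b 0) (b 1)]
    ring
  rw [h1, ← Finset.prod_pow, ← h2, h3]

/-- `covolume_span_nonneg` (docstring added by the landing lane; see the module docstring). [formal bookkeeping] -/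
theorem covolume_span_nonneg (b : Module.Basis (Fin 2) ℝ W) : 0 ≤ ZLattice.covolume (Submodule.span ℤ (Set.range ⇑b)) := by
  have h1 : ZLattice.covolume (Submodule.span ℤ (Set.range ⇑b)) = ∏ i, ‖InnerProductSpace.gramSchmidt ℝ (⇑b) i‖ :=
    covolume_latticeOfBasis_eq_prod_norm_gramSchmidt b
  rw [h1]; exact Finset.prod_nonneg fun i _ => norm_nonneg _

/-- ★ `covol(ℤb₀ + ℤb₁) = √(‖b₀‖²‖b₁‖² − ⟪b₀,b₁⟫²)`. [cite: Cohen1993, Prop. 2.5.4] -/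
theorem covolume_span_eq_sqrt_gramDet (b : Module.Basis (Fin 2) ℝ W) :
    ZLattice.covolume (Submodule.span ℤ (Set.range ⇑b)) = Real.sqrt (‖b 0‖ ^ 2 * ‖b 1‖ ^ 2 - ⟪b 0, b 1⟫_ℝ ^ 2) := by
  rw [← covolume_span_sq_eq_gramDet, Real.sqrt_sq (covolume_span_nonneg b)]

end Covolume

/-! ## §C2 Distance of a point from a plane: lower bound by any normal vector -/

/-- `|⟪s, ν⟫| / ‖ν‖ ≤ dist(s, K)` for `ν ∈ Kᗮ`, `ν ≠ 0`. [folklore] -/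
theorem abs_inner_div_norm_le_norm_sub_starProjection {F : Type*} [NormedAddCommGroup F] [InnerProductSpace ℝ F]
    (K : Submodule ℝ F) [K.HasOrthogonalProjection] {ν : F} (hν : ν ∈ Kᗮ) (hν0 : ν ≠ 0) (s : F) :
    |⟪s, ν⟫_ℝ| / ‖ν‖ ≤ ‖s - K.starProjection s‖ := by
  have h1 : ⟪s, ν⟫_ℝ = ⟪s - K.starProjection s, ν⟫_ℝ := by
    rw [inner_sub_left, Submodule.inner_right_of_mem_orthogonal (K.starProjection_apply_mem s) hν, sub_zero]
  rw [div_le_iff₀ (norm_pos_iff.2 hν0), h1]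
  exact abs_real_inner_le_norm _ _

/-- A vector orthogonal to `u` and `v` lies in `(span{u, v})ᗮ`. [folklore] -/
theorem mem_orthogonal_span_pair {F : Type*} [NormedAddCommGroup F] [InnerProductSpace ℝ F] {u v ν : F}
    (hu : ⟪u, ν⟫_ℝ = 0) (hv : ⟪v, ν⟫_ℝ = 0) : ν ∈ (Submodule.span ℝ (Set.range ![u, v]))ᗮ := by
  rw [Submodule.mem_orthogonal]
  intro x hx
  induction hx using Submodule.span_induction with
  | mem x hx =>
      obtain ⟨i, rfl⟩ := hx
      fin_cases i
      · exact hu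
      · exact hv
  | zero => exact inner_zero_left _
  | add x y _ _ hx hy => rw [inner_add_left, hx, hy, add_zero]
  | smul r x _ hx => rw [inner_smul_left, hx]; simp

/-! ## §C3 ★ The far-layer spread bound from a certified dual Bessel row -/

/-- The dual Bessel sum of `abs_layerSum_sub_layerSum_le` in kernel form: with `μ + 1 = σ` the summand is
`dualBesselTerm μ d ‖w‖`. [this file] -/
theorem spread_tsum_eq_tsum_dualBesselTerm {V : Type*} [NormedAddCommGroup V] [InnerProductSpace ℝ V]
    (Λ : Submodule ℤ V) {σ μ : ℕ} (hμ : μ + 1 = σ) (dd : ℝ) :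
    ∑' w : dualLattice Λ, (π * ‖(w : V)‖ / dd) ^ ((σ : ℝ) - 1) * besselKReal ((σ : ℝ) - 1) (2 * π * dd * ‖(w : V)‖) =
      ∑' w : dualLattice Λ, dualBesselTerm μ dd ‖(w : V)‖ := by
  have hcast : (σ : ℝ) - 1 = (μ : ℝ) := by rw [← hμ]; push_cast; ring
  simp only [hcast, dualBesselTerm]

/-- `tsum_dualBesselTerm_nonneg` (docstring added by the landing lane; see the module docstring). [formal bookkeeping] -/
theorem tsum_dualBesselTerm_nonneg {V : Type*} [NormedAddCommGroup V] [InnerProductSpace ℝ V]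
    (Λ : Submodule ℤ V) {μ : ℕ} (hμ : μ ≠ 0) {dd : ℝ} (hdd : 0 < dd) :
    0 ≤ ∑' w : dualLattice Λ, dualBesselTerm μ dd ‖(w : V)‖ := by
  refine tsum_nonneg fun w => ?_
  rcases (norm_nonneg (w : V)).eq_or_lt with h | h
  · rw [← h, dualBesselTerm_zero hμ]
  · exact dualBesselTerm_nonneg μ hdd h

/-- ★ **Far-layer coset spread from a certified dual Bessel row.**  If a row `R` passes `DualRow.check`, has
order `R.μ = σ − 1`, its Gram enclosures contain the layer Gram matrix `(⟪Btₐ, Bt_b⟫)` and `R.dlo ≤ d_k =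
dist(layerShift B o k, W_B)`, then for all labels `o, o'`:
`|layerSum B (2σ) k o − layerSum B (2σ) k o'| ≤ 4π/(Γ(σ)·√(R.Dlo)) · R.bound`.
(`abs_layerSum_sub_layerSum_le` ∘ `covol Λ_B = √det Gram ≥ √Dlo` ∘ `DualRow.check_sound`.) [this file] -/
theorem abs_layerSum_sub_layerSum_le_of_check (B : E3 →ₗ[ℝ] E3) (hB : Function.Injective B)
    [MeasurableSpace (Submodule.span ℝ (Set.range ![B (triangularVec₁ 1), B (triangularVec₂ 1)]))]
    [BorelSpace (Submodule.span ℝ (Set.range ![B (triangularVec₁ 1), B (triangularVec₂ 1)]))]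
    (σ : ℕ) (hσ : 1 < σ) {k : ℤ} (hk : k ≠ 0) (o o' : ℤ) (R : DualRow) (hR : R.check = true) (hμ : R.μ + 1 = σ)
    (h00 : (R.g00lo : ℝ) ≤ ‖B (triangularVec₁ 1)‖ ^ 2 ∧ ‖B (triangularVec₁ 1)‖ ^ 2 ≤ R.g00hi)
    (h01 : (R.g01lo : ℝ) ≤ ⟪B (triangularVec₁ 1), B (triangularVec₂ 1)⟫_ℝ ∧ ⟪B (triangularVec₁ 1), B (triangularVec₂ 1)⟫_ℝ ≤ R.g01hi)
    (h11 : (R.g11lo : ℝ) ≤ ‖B (triangularVec₂ 1)‖ ^ 2 ∧ ‖B (triangularVec₂ 1)‖ ^ 2 ≤ R.g11hi)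
    (hd : (R.dlo : ℝ) ≤ ‖layerShift B o k - (Submodule.span ℝ
        (Set.range ![B (triangularVec₁ 1), B (triangularVec₂ 1)])).starProjection (layerShift B o k)‖) :
    |layerSum B (2 * σ) k o - layerSum B (2 * σ) k o'| ≤ 4 * π / (Real.Gamma σ * Real.sqrt R.Dlo) * R.bound := by
  -- unpack the certificate facts we need: `1 ≤ μ`, `0 < dlo`, `0 < g00lo`, `0 < g11lo`, `0 < Dlo`
  have hR' := hR
  simp only [DualRow.check, Bool.and_eq_true, decide_eq_true_eq, List.all_eq_true, Bool.or_eq_true] at hR'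
  obtain ⟨⟨⟨⟨⟨⟨⟨⟨⟨⟨⟨⟨⟨⟨⟨⟨⟨⟨hμ1, hdlo⟩, hg00⟩, hg11⟩, -⟩, -⟩, -⟩, hDlo⟩, -⟩, -⟩, -⟩, -⟩, -⟩, -⟩, -⟩, -⟩, -⟩,
    -⟩, -⟩ := hR'
  set b : Module.Basis (Fin 2) ℝ (Submodule.span ℝ (Set.range ![B (triangularVec₁ 1), B (triangularVec₂ 1)])) :=
    Module.Basis.span (linearIndependent_map_pair B hB) with hbdef
  set dd : ℝ := ‖layerShift B o k - (Submodule.span ℝ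
        (Set.range ![B (triangularVec₁ 1), B (triangularVec₂ 1)])).starProjection (layerShift B o k)‖ with hdd
  have hb0 : ((b 0 : Submodule.span ℝ (Set.range ![B (triangularVec₁ 1), B (triangularVec₂ 1)])) : E3) =
      B (triangularVec₁ 1) := by rw [hbdef, Module.Basis.span_apply]; rfl
  have hb1 : ((b 1 : Submodule.span ℝ (Set.range ![B (triangularVec₁ 1), B (triangularVec₂ 1)])) : E3) =
      B (triangularVec₂ 1) := by rw [hbdef, Module.Basis.span_apply]; rfl
  have hn0 : ‖b 0‖ = ‖B (triangularVec₁ 1)‖ := by rw [Submodule.coe_norm, hb0]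
  have hn1 : ‖b 1‖ = ‖B (triangularVec₂ 1)‖ := by rw [Submodule.coe_norm, hb1]
  have hi01 : ⟪b 0, b 1⟫_ℝ = ⟪B (triangularVec₁ 1), B (triangularVec₂ 1)⟫_ℝ := by rw [Submodule.coe_inner, hb0, hb1]
  have hspan : ∀ v : Submodule.span ℝ (Set.range ![B (triangularVec₁ 1), B (triangularVec₂ 1)]),
      v ∈ Submodule.span ℝ (Set.range ⇑b) := fun v => b.mem_span v
  have hdlo' : (0 : ℝ) < R.dlo := by exact_mod_cast hdlo
  have hdd0 : 0 < dd := lt_of_lt_of_le hdlo' hd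
  have hμ0 : R.μ ≠ 0 := by omega
  -- the certified sum
  have hsum : ∑' w : dualLattice (Submodule.span ℤ (Set.range ⇑b)),
      dualBesselTerm R.μ dd ‖(w : Submodule.span ℝ (Set.range ![B (triangularVec₁ 1), B (triangularVec₂ 1)]))‖ ≤
        R.bound :=
    R.check_sound hR (⇑b) hspan (by rw [hn0]; exact h00) (by rw [hi01]; exact h01) (by rw [hn1]; exact h11) hd
  have hsum0 := tsum_dualBesselTerm_nonneg (Submodule.span ℤ (Set.range ⇑b)) hμ0 hdd0
  -- the covolume
  have hD : ((R.Dlo : ℚ) : ℝ) ≤ ‖b 0‖ ^ 2 * ‖b 1‖ ^ 2 - ⟪b 0, b 1⟫_ℝ ^ 2 := by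
    rw [hn0, hn1, hi01]; exact R.Dlo_le hg00.le hg11.le h00.1 h01 h11.1
  have hDlo' : (0 : ℝ) < R.Dlo := by exact_mod_cast hDlo
  have hcov : Real.sqrt R.Dlo ≤ ZLattice.covolume (Submodule.span ℤ (Set.range ⇑b)) := by
    rw [covolume_span_eq_sqrt_gramDet b]; exact Real.sqrt_le_sqrt hD
  have hsq0 : 0 < Real.sqrt R.Dlo := Real.sqrt_pos.2 hDlo'
  have hΓ : 0 < Real.Gamma σ := Real.Gamma_pos_of_pos (by exact_mod_cast (by omega : 0 < σ))
  -- assemble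
  have hmain := abs_layerSum_sub_layerSum_le B hB σ hσ hk o o'
  rw [spread_tsum_eq_tsum_dualBesselTerm _ hμ] at hmain
  refine hmain.trans ?_
  have hpi : 4 * Real.sqrt π ^ 2 = 4 * π := by rw [Real.sq_sqrt Real.pi_pos.le]
  rw [hpi]
  have hA : 4 * π / (Real.Gamma σ * ZLattice.covolume (Submodule.span ℤ (Set.range ⇑b))) ≤
      4 * π / (Real.Gamma σ * Real.sqrt R.Dlo) :=
    div_le_div_of_nonneg_left (by positivity) (mul_pos hΓ hsq0) (mul_le_mul_of_nonneg_left hcov hΓ.le)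
  exact mul_le_mul hA hsum hsum0 (by positivity)

/-! ## §C4 Demo: the hcp reference cell (`B = id`) — layer Gram, layer distance `d_k = |k|√(2/3)`,
and the far-layer spread at `k = ±4`, `n = 12` -/

/-- For `B = id`: `‖t₁‖ = 1`. -/
theorem norm_triangularVec₁_one : ‖(triangularVec₁ (1 : ℝ) : E3)‖ = 1 := by
  rw [EuclideanSpace.norm_eq, Fin.sum_univ_three]
  simp [triangularVec₁]

/-- For `B = id`: `‖t₂‖ = 1`. -/
theorem norm_triangularVec₂_one : ‖(triangularVec₂ (1 : ℝ) : E3)‖ = 1 := by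
  rw [EuclideanSpace.norm_eq, Fin.sum_univ_three]
  have h3 : Real.sqrt 3 ^ 2 = 3 := Real.sq_sqrt (by norm_num)
  simp [triangularVec₂, div_pow, h3]
  norm_num

/-- For `B = id`: `⟪t₁, t₂⟫ = 1/2`. -/
theorem inner_triangularVec_one : ⟪(triangularVec₁ (1 : ℝ) : E3), triangularVec₂ 1⟫_ℝ = 1 / 2 := by
  rw [EuclideanSpace.inner_eq_star_dotProduct]
  simp [triangularVec₁, triangularVec₂, dotProduct, Fin.sum_univ_three]

/-- The unit normal `e₃` is orthogonal to `t₁`. -/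
theorem inner_triangularVec₁_single_two :
    ⟪(triangularVec₁ (1 : ℝ) : E3), EuclideanSpace.single 2 (1 : ℝ)⟫_ℝ = 0 := by
  rw [EuclideanSpace.inner_single_right]; simp [triangularVec₁]

/-- The unit normal `e₃` is orthogonal to `t₂`. -/
theorem inner_triangularVec₂_single_two :
    ⟪(triangularVec₂ (1 : ℝ) : E3), EuclideanSpace.single 2 (1 : ℝ)⟫_ℝ = 0 := by
  rw [EuclideanSpace.inner_single_right]; simp [triangularVec₂]

/-- The height of the far layer `k` over the reference plane: `⟪layerShift id o k, e₃⟫ = k√(2/3)`. -/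
theorem inner_layerShift_id_single_two (o k : ℤ) :
    ⟪layerShift (LinearMap.id : E3 →ₗ[ℝ] E3) o k, EuclideanSpace.single 2 (1 : ℝ)⟫_ℝ = k * Real.sqrt (2 / 3) := by
  rw [EuclideanSpace.inner_single_right, layerShift, LinearMap.id_apply, LinearMap.id_apply]
  simp [barlowOffset, layerNormal]

/-- ★ For the reference cell `B = id`: `dist(layerShift id o k, W) ≥ |k|·√(2/3)` (in fact equality). [this file] -/
theorem abs_mul_sqrt_le_dist_layerShift_id (o k : ℤ) :
    |(k : ℝ)| * Real.sqrt (2 / 3) ≤ ‖layerShift (LinearMap.id : E3 →ₗ[ℝ] E3) o k - (Submodule.span ℝ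
      (Set.range ![(LinearMap.id : E3 →ₗ[ℝ] E3) (triangularVec₁ 1), (LinearMap.id : E3 →ₗ[ℝ] E3) (triangularVec₂ 1)])).starProjection
        (layerShift (LinearMap.id : E3 →ₗ[ℝ] E3) o k)‖ := by
  have hν0 : (EuclideanSpace.single 2 (1 : ℝ) : E3) ≠ 0 := by
    intro h
    have := congrArg (fun v : E3 => v 2) h
    simp at this
  have hν : (EuclideanSpace.single 2 (1 : ℝ) : E3) ∈ (Submodule.span ℝ
      (Set.range ![(LinearMap.id : E3 →ₗ[ℝ] E3) (triangularVec₁ 1), (LinearMap.id : E3 →ₗ[ℝ] E3) (triangularVec₂ 1)]))ᗮ := by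
    refine mem_orthogonal_span_pair ?_ ?_
    · rw [LinearMap.id_apply]; exact inner_triangularVec₁_single_two
    · rw [LinearMap.id_apply]; exact inner_triangularVec₂_single_two
  have hn : ‖(EuclideanSpace.single 2 (1 : ℝ) : E3)‖ = 1 := by
    rw [EuclideanSpace.norm_eq, Fin.sum_univ_three]; simp
  have h := abs_inner_div_norm_le_norm_sub_starProjection _ hν hν0 (layerShift (LinearMap.id : E3 →ₗ[ℝ] E3) o k)
  rw [inner_layerShift_id_single_two, hn, div_one, abs_mul, abs_of_nonneg (Real.sqrt_nonneg _)] at h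
  exact h

/-- `√(2/3) ≥ 0.8164`, hence `d_k ≥ 3.2656 ≥ 653/200` for `|k| ≥ 4`. -/
theorem dlo_le_dist_layerShift_id {k : ℤ} (hk : 4 ≤ |k|) (o : ℤ) :
    ((653 / 200 : ℚ) : ℝ) ≤ ‖layerShift (LinearMap.id : E3 →ₗ[ℝ] E3) o k - (Submodule.span ℝ
      (Set.range ![(LinearMap.id : E3 →ₗ[ℝ] E3) (triangularVec₁ 1), (LinearMap.id : E3 →ₗ[ℝ] E3) (triangularVec₂ 1)])).starProjection
        (layerShift (LinearMap.id : E3 →ₗ[ℝ] E3) o k)‖ := by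
  refine le_trans ?_ (abs_mul_sqrt_le_dist_layerShift_id o k)
  have hs : (8164 / 10000 : ℝ) ≤ Real.sqrt (2 / 3) := by
    rw [show (8164 / 10000 : ℝ) = Real.sqrt ((8164 / 10000) ^ 2) by rw [Real.sqrt_sq (by norm_num)]]
    exact Real.sqrt_le_sqrt (by norm_num)
  have hk' : (4 : ℝ) ≤ |(k : ℝ)| := by rw [← Int.cast_abs]; exact_mod_cast hk
  push_cast
  nlinarith [hs, hk', abs_nonneg (k : ℝ)]

/-- The layer Gram enclosures of the reference cell for the demo rows (exact Gram `1, 1/2, 1`). -/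
theorem gram_id_encl :
    (((1 : ℚ) : ℝ) ≤ ‖(LinearMap.id : E3 →ₗ[ℝ] E3) (triangularVec₁ 1)‖ ^ 2 ∧
        ‖(LinearMap.id : E3 →ₗ[ℝ] E3) (triangularVec₁ 1)‖ ^ 2 ≤ ((1 : ℚ) : ℝ)) ∧
      (((1 / 2 : ℚ) : ℝ) ≤ ⟪(LinearMap.id : E3 →ₗ[ℝ] E3) (triangularVec₁ 1), (LinearMap.id : E3 →ₗ[ℝ] E3) (triangularVec₂ 1)⟫_ℝ ∧
        ⟪(LinearMap.id : E3 →ₗ[ℝ] E3) (triangularVec₁ 1), (LinearMap.id : E3 →ₗ[ℝ] E3) (triangularVec₂ 1)⟫_ℝ ≤ ((1 / 2 : ℚ) : ℝ)) ∧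
      (((1 : ℚ) : ℝ) ≤ ‖(LinearMap.id : E3 →ₗ[ℝ] E3) (triangularVec₂ 1)‖ ^ 2 ∧
        ‖(LinearMap.id : E3 →ₗ[ℝ] E3) (triangularVec₂ 1)‖ ^ 2 ≤ ((1 : ℚ) : ℝ)) := by
  simp only [LinearMap.id_apply, norm_triangularVec₁_one, norm_triangularVec₂_one, inner_triangularVec_one]
  norm_num

/-- ★ **End-to-end certificate (hcp reference cell, `n = 12`, far layers `|k| ≥ 4`).**
`|layerSum id 12 k o − layerSum id 12 k o'| ≤ 4.44·10⁻¹¹` — the `r⁻¹²` sum of a far layer is registry-independent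
to `4.44·10⁻¹¹` (in units of the nearest-neighbour distance). [this file] -/
theorem abs_layerSum_twelve_sub_le_hcpRef {k : ℤ} (hk : 4 ≤ |k|) (o o' : ℤ) :
    |layerSum (LinearMap.id : E3 →ₗ[ℝ] E3) 12 k o - layerSum (LinearMap.id : E3 →ₗ[ℝ] E3) 12 k o'| ≤ 444 / 10 ^ 13 := by
  letI : MeasurableSpace (Submodule.span ℝ
      (Set.range ![(LinearMap.id : E3 →ₗ[ℝ] E3) (triangularVec₁ 1), (LinearMap.id : E3 →ₗ[ℝ] E3) (triangularVec₂ 1)])) := borel _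
  haveI : BorelSpace (Submodule.span ℝ
      (Set.range ![(LinearMap.id : E3 →ₗ[ℝ] E3) (triangularVec₁ 1), (LinearMap.id : E3 →ₗ[ℝ] E3) (triangularVec₂ 1)])) := ⟨rfl⟩
  have hk0 : k ≠ 0 := by rintro rfl; simp at hk
  have hinj : Function.Injective (LinearMap.id : E3 →ₗ[ℝ] E3) := fun x y h => h
  have h := abs_layerSum_sub_layerSum_le_of_check LinearMap.id hinj 6 (by norm_num) hk0 o o' demoRowHcpK4Mu5
    demoRowHcpK4Mu5_check rfl gram_id_encl.1 gram_id_encl.2.1 gram_id_encl.2.2 (dlo_le_dist_layerShift_id hk o)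
  have hDlo : demoRowHcpK4Mu5.Dlo = 3 / 4 := by decide +kernel
  have hbd : demoRowHcpK4Mu5.bound = 3669 / 10 ^ 13 := by decide +kernel
  have hΓ : Real.Gamma ((6 : ℕ) : ℝ) = 120 := by
    rw [show ((6 : ℕ) : ℝ) = (5 : ℕ) + 1 by norm_num, Real.Gamma_nat_eq_factorial]; norm_num [Nat.factorial]
  rw [hDlo, hbd, hΓ] at h
  have hs : (433 / 500 : ℝ) ≤ Real.sqrt ((3 / 4 : ℚ) : ℝ) := by
    rw [show (433 / 500 : ℝ) = Real.sqrt ((433 / 500) ^ 2) by rw [Real.sqrt_sq (by norm_num)]]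
    exact Real.sqrt_le_sqrt (by norm_num)
  have h1 : 4 * π / (120 * Real.sqrt ((3 / 4 : ℚ) : ℝ)) ≤ 4 * 3.141593 / (120 * (433 / 500)) :=
    div_le_div₀ (by norm_num) (by nlinarith [Real.pi_lt_d6]) (by norm_num) (by nlinarith [hs])
  refine h.trans ?_
  calc 4 * π / (120 * Real.sqrt ((3 / 4 : ℚ) : ℝ)) * (((3669 / 10 ^ 13 : ℚ)) : ℝ)
      ≤ 4 * 3.141593 / (120 * (433 / 500)) * (((3669 / 10 ^ 13 : ℚ)) : ℝ) :=
        mul_le_mul_of_nonneg_right h1 (by norm_num)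
    _ ≤ 444 / 10 ^ 13 := by norm_num

/-- ★ **End-to-end certificate (hcp reference cell, `n = 6`, far layers `|k| ≥ 4`).**
`|layerSum id 6 k o − layerSum id 6 k o'| ≤ 8.98·10⁻¹⁰`. [this file] -/
theorem abs_layerSum_six_sub_le_hcpRef {k : ℤ} (hk : 4 ≤ |k|) (o o' : ℤ) :
    |layerSum (LinearMap.id : E3 →ₗ[ℝ] E3) 6 k o - layerSum (LinearMap.id : E3 →ₗ[ℝ] E3) 6 k o'| ≤ 898 / 10 ^ 12 := by
  letI : MeasurableSpace (Submodule.span ℝ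
      (Set.range ![(LinearMap.id : E3 →ₗ[ℝ] E3) (triangularVec₁ 1), (LinearMap.id : E3 →ₗ[ℝ] E3) (triangularVec₂ 1)])) := borel _
  haveI : BorelSpace (Submodule.span ℝ
      (Set.range ![(LinearMap.id : E3 →ₗ[ℝ] E3) (triangularVec₁ 1), (LinearMap.id : E3 →ₗ[ℝ] E3) (triangularVec₂ 1)])) := ⟨rfl⟩
  have hk0 : k ≠ 0 := by rintro rfl; simp at hk
  have hinj : Function.Injective (LinearMap.id : E3 →ₗ[ℝ] E3) := fun x y h => h
  have h := abs_layerSum_sub_layerSum_le_of_check LinearMap.id hinj 3 (by norm_num) hk0 o o' demoRowHcpK4Mu2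
    demoRowHcpK4Mu2_check rfl gram_id_encl.1 gram_id_encl.2.1 gram_id_encl.2.2 (dlo_le_dist_layerShift_id hk o)
  have hDlo : demoRowHcpK4Mu2.Dlo = 3 / 4 := by decide +kernel
  have hbd : demoRowHcpK4Mu2.bound = 1236 / 10 ^ 13 := by decide +kernel
  have hΓ : Real.Gamma ((3 : ℕ) : ℝ) = 2 := by
    rw [show ((3 : ℕ) : ℝ) = (2 : ℕ) + 1 by norm_num, Real.Gamma_nat_eq_factorial]; norm_num [Nat.factorial]
  rw [hDlo, hbd, hΓ] at h
  have hs : (433 / 500 : ℝ) ≤ Real.sqrt ((3 / 4 : ℚ) : ℝ) := by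
    rw [show (433 / 500 : ℝ) = Real.sqrt ((433 / 500) ^ 2) by rw [Real.sqrt_sq (by norm_num)]]
    exact Real.sqrt_le_sqrt (by norm_num)
  have h1 : 4 * π / (2 * Real.sqrt ((3 / 4 : ℚ) : ℝ)) ≤ 4 * 3.141593 / (2 * (433 / 500)) :=
    div_le_div₀ (by norm_num) (by nlinarith [Real.pi_lt_d6]) (by norm_num) (by nlinarith [hs])
  refine h.trans ?_
  calc 4 * π / (2 * Real.sqrt ((3 / 4 : ℚ) : ℝ)) * (((1236 / 10 ^ 13 : ℚ)) : ℝ)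
      ≤ 4 * 3.141593 / (2 * (433 / 500)) * (((1236 / 10 ^ 13 : ℚ)) : ℝ) :=
        mul_le_mul_of_nonneg_right h1 (by norm_num)
    _ ≤ 898 / 10 ^ 12 := by norm_num

end Summit.AtomisticToContinuum.Crystallization.Theorems.OverbindingBudgetAffineFarSmoothSplit

end
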